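import Summits.BirchSwinnertonDyer.BirchSwinnertonDyer.Theorems.BiquadraticEisensteinDescentKatzWaldspurgerFrameCMInertBadFlatBody
import Literature.NumberTheory.EllipticCurves.ComplexMultiplicationNotSemistable
import HarnessLib

/-!
# Route `BiquadraticEisensteinDescent` (W-ALL row 12 · K12i), crux (W♭) — the frame body WITHOUT the admissibility
# binder (director-bsd ruling W-16 «Δ-h⁻», 2026-08-27T15:15:08Z), BY VALUE — no `Theses` import (file W″)

Prover seat `bsd-wall-bed-p2` (g7), cell `bsd-wall`. THEOREMS ONLY (0 definitions, 0 named facts, 0 sorry); CONDITIONAL on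
the two refereed named facts exactly as `…KatzWaldspurgerFrameCMInertBadFlatBody.w9` (p522314): Hsieh 2014 Thm A any
level and LZZ 2018 §1.5 at `p² ∣ N` (p518041) — both are ANTECEDENTS here. `w9` (the closer of the support item
`KatzWaldspurgerFrameCMInertBadFlatOfLZZ`, stmt-20325) binds the quartic class-number hypothesis
`(∀ L quartic, √d_CM ∈ L → √d_K′ ∈ L → ¬ p ∣ h(L)) →` of the K′-supply crux KS (stmt-20198) as `_`: the value of the
♭-frame at `𝟙` comes from `frame_value_of_lzz`, which has no class-number hypothesis at all. Under Δ-h⁻ (KS superseded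
by its K′-form `… ∧ ¬ p ∣ h(K′)`), the deciding theorem is re-pointed through a frame statement without the quartic
binder; this file supplies it in BOTH candidate shapes so that the closer of whichever text the route author files is
one line:

* `w10` — `w9` with the quartic binder DELETED (`Hsieh → LZZ → body`); proof = the proof of `w9` verbatim
  (`p² ∣ N` from CM + bad, `p` split in `K′` from the Heegner hypothesis, `d_K′ < −4`, then `frame_value_of_lzz`).
* `w10K` — the same with `¬ p ∣ NumberField.classNumber K →` in the binder's slot (the literal Δ-h⁻ weakening);
  one line over `w10`.

BSD is not proved by this file. References: [LiuZhangZhang2018] Duke Math. J. 167 (2018) Thm 1.5.1, Thm 1.5.3;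
[Hsieh2014] Doc. Math. 19 (2014) Thm A; [Castella2018] Thms. 3.1–3.2.
-/

set_option autoImplicit false

-- D-0017 layout: summit = sub-problem, so `Summit.BirchSwinnertonDyer.BirchSwinnertonDyer.…` is the
-- mandated namespace of Theorems files (same option as the route's sibling Theorems files).
set_option linter.dupNamespace false

noncomputable section

open scoped Classical NumberField

namespace Summit.BirchSwinnertonDyer.BirchSwinnertonDyer.Theorems.KatzWaldspurgerFrameCMInertBadFlatKPrimeBody

open WeierstrassCurve NumberField IsDedekindDomain Field
  Literature.NumberTheory.EllipticCurves Literature.NumberTheory.EllipticCurves.ModularForms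
  Literature.NumberTheory.EllipticCurves.Rank1Residual
  Summit.BirchSwinnertonDyer.Rank1Residual Summit.BirchSwinnertonDyer.Rank1Residual.X11b
  KatzWaldspurgerFrameCMInertBadFlatBody

/-- **W″ = (W♭) `Hsieh any-level → LZZ additive → <frame body>` with NO class-number binder.** At every datum of the
crux (CM, analytic rank one, `p ≥ 5` inert in the CM field and bad, `K′` imaginary quadratic Heegner with `|d_K′| > 4`,
Heegner datum with `p ∤ c`, `L(W^{d_K′},1) ≠ 0`, `(κ, γ)` anticyclotomic, `𝔭 ∋ p` of degree one) the ♭-frame of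
`…FromPrint.exists_frameInt_of_thmA_anyLevel` has value `u·(log_{ω_E} P)²` at `𝟙` with `‖u‖ ≤ 1`
(`KatzWaldspurgerFrameCMInertBadFlatBody.frame_value_of_lzz`). Same content and proof as `…FlatBody.w9` (p522314),
which binds the quartic class-number hypothesis unused. CONDITIONAL on the two refereed named facts (antecedents).
[cite: LiuZhangZhang2018, Thm 1.5.1 and Thm 1.5.3 (Duke Math. J. 167 pp. 748–749)]
[cite: Hsieh2014, Thm. A p. 712 (Doc. Math. 19) = Thm. 1 (arXiv:1112.1580 pp. 3–4)] -/
theorem w10 :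
    Literature.NumberTheory.EllipticCurves.Hsieh2014.thmA_exists_isHsiehLFunction_unrPeriod_anyLevel → Literature.NumberTheory.EllipticCurves.LiuZhangZhang2018.thm151_thm153_modularCurve_heegnerVector_additive → ∀ (W : WeierstrassCurve ℚ) [W.IsElliptic] [W.IsGloballyMinimal] (p : ℕ) [Fact p.Prime] [NeZero (W.conductorNorm ℤ)] (K : Type) [Field K] [NumberField K] (Dt : Literature.NumberTheory.EllipticCurves.ModularForms.ModularParametrizationData W (W.conductorNorm ℤ)) (H : Literature.NumberTheory.EllipticCurves.HeegnerDatum (W.conductorNorm ℤ) (NumberField.discr K)) (ι : K →+* ℂ) (P : (W.baseChange K).toAffine.Point), W.HasCM → W.analyticRank = 1 → 5 ≤ p → Literature.NumberTheory.EllipticCurves.Rank1Residual.CMInert W p → ¬ Literature.NumberTheory.EllipticCurves.Rank1Residual.Good W p → Literature.NumberTheory.EllipticCurves.IsImaginaryQuadratic K → Literature.NumberTheory.EllipticCurves.SatisfiesHeegnerHypothesis (W.conductorNorm ℤ) K → 4 < (NumberField.discr K).natAbs → WeierstrassCurve.Affine.Point.map ι.toRatAlgHom P = Literature.NumberTheory.EllipticCurves.ModularForms.heegnerPointComplex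 Dt H → ¬ (p : ℤ) ∣ Dt.c → (W.quadraticTwist (NumberField.discr K : ℚ)).entireLFunction 1 ≠ 0 → ∀ (κ : Literature.NumberTheory.EllipticCurves.ZpExtension K p), κ.IsAnticyclotomic → ∀ (γ : Field.absoluteGaloisGroup K) [Fact (κ.IsTopGenerator γ)] (𝔭 : IsDedekindDomain.HeightOneSpectrum (NumberField.RingOfIntegers K)) (h𝔭 : ((p : ℕ) : NumberField.RingOfIntegers K) ∈ 𝔭.asIdeal) (he : 𝔭.asIdeal.ramificationIdx (NumberField.RingOfIntegers ℚ) = 1) (hf : 𝔭.asIdeal.inertiaDeg (NumberField.RingOfIntegers ℚ) = 1), ∃ (f : CuspForm (CongruenceSubgroup.Gamma0 (W.conductorNorm ℤ)) 2), Literature.NumberTheory.EllipticCurves.ModularForms.IsNewformOf W f ∧ ∃ ι' : PadicAlgCl p ≃+* ℂ, (∀ (w : NumberField.InfinitePlace K) (k : NumberField.RingOfIntegers K), k ∈ 𝔭.asIdeal ↔ ‖ι'.symm (w.embedding (k : K))‖ < 1) ∧ ∃ (ΩK : ℂ) (Ωp : (Literature.NumberTheory.EllipticCurves.unrIntegers p)ˣ)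 (Q : PowerSeries (PadicComplexInt p)), ΩK ≠ 0 ∧ Summit.BirchSwinnertonDyer.Rank1Residual.X11b.R1.IsBDPLFunctionInt p ι' 𝔭 κ γ f ΩK ((Ωp : Literature.NumberTheory.EllipticCurves.unrIntegers p) : (PadicComplex p)) Q ∧ ∃ u : PadicComplex p, ‖u‖ ≤ 1 ∧ Literature.NumberTheory.EllipticCurves.IntSeries.HasValueAt Q 0 (u * (algebraMap (Padic p) (PadicComplex p) (Summit.BirchSwinnertonDyer.Rank1Residual.X11b.Halves.logOmega W p (Summit.BirchSwinnertonDyer.Rank1Residual.X11b.embAt K p 𝔭 h𝔭 he hf) P)) ^ 2) := by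
  intro hA hL W _ _ p _ _ K _ _ Dt H ι P hCM _ hp5 _ hbad hK hHN hd4 hP hcM _ κ hκ γ hγ 𝔭 h𝔭 he hf
  have hp : p.Prime := Fact.out
  have hpN : p ∣ W.conductorNorm ℤ := (W.dvd_conductorNorm_iff_not_hasGoodReductionAtPrime p).mpr hbad
  -- CM + bad ⟹ additive: `p² ∣ N`
  have hp2N : p ^ 2 ∣ W.conductorNorm ℤ := by
    by_contra h
    rcases hasGoodReductionAtPrime_or_hasMultiplicativeReductionAtPrime_of_not_sq_dvd_conductorNorm (V := W) h
      with hg | hm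
    · exact hbad hg
    · exact not_mult_of_hasCM W hCM p hm
  have hsplit : ((Ideal.span {(p : ℤ)}).primesOver (𝓞 K)).ncard = 2 := hHN p hp hpN
  -- `d_K′ < −4`
  have hd4' : NumberField.discr K < -4 := by
    have hneg : NumberField.discr K < 0 := by
      haveI : IsTotallyComplex K := hK.2
      exact discr_neg_of_finrank_eq_two K hK.1
    have habs : ((NumberField.discr K).natAbs : ℤ) = -NumberField.discr K := Int.ofNat_natAbs_of_nonpos hneg.le
    have : (4 : ℤ) < ((NumberField.discr K).natAbs : ℤ) := by exact_mod_cast hd4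
    omega
  exact frame_value_of_lzz hA hL W K 𝔭 κ γ Dt H ι P hp5 hbad hp2N hK hd4' hsplit h𝔭 he hf hHN hκ hcM hP

/-- **W″ in the literal Δ-h⁻ shape**: `w10` with `¬ p ∣ h(K′) →` in the slot of the old quartic class-number binder
(unused — the value of the frame at `𝟙` does not see class numbers). One line over `w10`.
[cite: LiuZhangZhang2018, Thm 1.5.1 and Thm 1.5.3 (Duke Math. J. 167 pp. 748–749)]
[cite: Hsieh2014, Thm. A p. 712 (Doc. Math. 19) = Thm. 1 (arXiv:1112.1580 pp. 3–4)] -/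
theorem w10K :
    Literature.NumberTheory.EllipticCurves.Hsieh2014.thmA_exists_isHsiehLFunction_unrPeriod_anyLevel → Literature.NumberTheory.EllipticCurves.LiuZhangZhang2018.thm151_thm153_modularCurve_heegnerVector_additive → ∀ (W : WeierstrassCurve ℚ) [W.IsElliptic] [W.IsGloballyMinimal] (p : ℕ) [Fact p.Prime] [NeZero (W.conductorNorm ℤ)] (K : Type) [Field K] [NumberField K] (Dt : Literature.NumberTheory.EllipticCurves.ModularForms.ModularParametrizationData W (W.conductorNorm ℤ)) (H : Literature.NumberTheory.EllipticCurves.HeegnerDatum (W.conductorNorm ℤ) (NumberField.discr K)) (ι : K →+* ℂ) (P : (W.baseChange K).toAffine.Point), W.HasCM → W.analyticRank = 1 → 5 ≤ p → Literature.NumberTheory.EllipticCurves.Rank1Residual.CMInert W p → ¬ Literature.NumberTheory.EllipticCurves.Rank1Residual.Good W p → Literature.NumberTheory.EllipticCurves.IsImaginaryQuadratic K → Literature.NumberTheory.EllipticCurves.SatisfiesHeegnerHypothesis (W.conductorNorm ℤ) K → 4 < (NumberField.discr K).natAbs → ¬ p ∣ NumberField.classNumber K → WeierstrassCurve.Affine.Point.map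 ι.toRatAlgHom P = Literature.NumberTheory.EllipticCurves.ModularForms.heegnerPointComplex Dt H → ¬ (p : ℤ) ∣ Dt.c → (W.quadraticTwist (NumberField.discr K : ℚ)).entireLFunction 1 ≠ 0 → ∀ (κ : Literature.NumberTheory.EllipticCurves.ZpExtension K p), κ.IsAnticyclotomic → ∀ (γ : Field.absoluteGaloisGroup K) [Fact (κ.IsTopGenerator γ)] (𝔭 : IsDedekindDomain.HeightOneSpectrum (NumberField.RingOfIntegers K)) (h𝔭 : ((p : ℕ) : NumberField.RingOfIntegers K) ∈ 𝔭.asIdeal) (he : 𝔭.asIdeal.ramificationIdx (NumberField.RingOfIntegers ℚ) = 1) (hf : 𝔭.asIdeal.inertiaDeg (NumberField.RingOfIntegers ℚ) = 1), ∃ (f : CuspForm (CongruenceSubgroup.Gamma0 (W.conductorNorm ℤ)) 2), Literature.NumberTheory.EllipticCurves.ModularForms.IsNewformOf W f ∧ ∃ ι' : PadicAlgCl p ≃+* ℂ, (∀ (w : NumberField.InfinitePlace K) (k : NumberField.RingOfIntegers K), k ∈ 𝔭.asIdeal ↔ ‖ι'.symm (w.embedding (k : K))‖ < 1) ∧ ∃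 (ΩK : ℂ) (Ωp : (Literature.NumberTheory.EllipticCurves.unrIntegers p)ˣ) (Q : PowerSeries (PadicComplexInt p)), ΩK ≠ 0 ∧ Summit.BirchSwinnertonDyer.Rank1Residual.X11b.R1.IsBDPLFunctionInt p ι' 𝔭 κ γ f ΩK ((Ωp : Literature.NumberTheory.EllipticCurves.unrIntegers p) : (PadicComplex p)) Q ∧ ∃ u : PadicComplex p, ‖u‖ ≤ 1 ∧ Literature.NumberTheory.EllipticCurves.IntSeries.HasValueAt Q 0 (u * (algebraMap (Padic p) (PadicComplex p) (Summit.BirchSwinnertonDyer.Rank1Residual.X11b.Halves.logOmega W p (Summit.BirchSwinnertonDyer.Rank1Residual.X11b.embAt K p 𝔭 h𝔭 he hf) P)) ^ 2) := by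
  intro hA hL W _ _ p _ _ K _ _ Dt H ι P hCM hr hp5 hin hbad hK hHN hd4 _hh hP hcM hLt κ hκ γ hγ 𝔭 h𝔭 he hf
  exact w10 hA hL W p K Dt H ι P hCM hr hp5 hin hbad hK hHN hd4 hP hcM hLt κ hκ γ 𝔭 h𝔭 he hf

end Summit.BirchSwinnertonDyer.BirchSwinnertonDyer.Theorems.KatzWaldspurgerFrameCMInertBadFlatKPrimeBody

end
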